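import Literature.MathematicalPhysics.QuantumFieldTheory.Balaban1983to89.T3NestedUnitLaws
import Literature.MathematicalPhysics.QuantumFieldTheory.Balaban1983to89.StepInhabited

/-!
# `Balaban1983to89.T3UnitLawDensity` — THE UNIT LAW OF THE d = 3 SCHEME IS BAŁABAN'S RENORMALISED DENSITY `ρ_K dV / Z^ε`:
# for every tower of renormalization transformations over the scheme's (0.4) averagings (`Step.DensityRGI`, inhabited carrier
# `RTOpI`), `∫ f d(unitLaw K) = Z⁻¹ ∫ ρ_K(V) f(V) dV` — the bridge from the LAW currency of the E3 node to the DENSITY currency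
# of [Balaban1985UV3] (1)–(2), (6)

Cell `ym3-torus` (HUMAN RULING D-0037, YM ladder rung R3), seat `ym3-torus-p2` gen 2.  WHAT THIS IS NOT: not d = 4, not infinite
volume, not a mass gap, not Clay, not (E3); no renormalization transformation is CONSTRUCTED here (the tower `T` is a parameter
in the tree's inhabited carrier `RTOpI`, [Balaban1985Averaging] (10)), and no bound of [Balaban1985UV3] is asserted.

THE POINT.  `T3ThresholdRemoval`/`T3NestedUnitLaws` state the d = 3 expectations step over the UNIT LAWS `μ_K = (A_K)_* Gibbs_K`
(`continuumYM3Torus_of_densitySandwich[ModConst]`: a two-run sandwich of DENSITIES of the unit laws on good sets plus bad-set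
masses gives `ContinuumYM3Torus`).  [Balaban1985UV3] speaks of the DENSITIES `ρ_k`: «ρ₀(U) = exp[−(1/g₀²)A(U) − E] (1) …
a sequence of densities ρ_k defined inductively by ρ_{k+1} = Tρ_k (2)» and «∫dUρ_k = ∫dUT^kρ₀ = ∫dUρ₀ = Z^ε (6)».  This
module proves that
these are THE SAME OBJECTS: for the d = 3 Wilson scheme at step `K` (Boltzmann weight `e^{−β_K A}`, `β_K = (γε_K)⁻¹`, i.e. (1) with
`g₀² = γε_K`, `E = 0`) and ANY family `T_j` of renormalization transformations over the scheme's block averagings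
`BlockAveraging.blockAvg ℰ` (push-forward identity `Setup.IsRT`), the free tower `ρ_{k+1} = T_kρ_k` satisfies
`∫ ρ_k(V)·f(V) dV_k = ∫ ρ₀(U)·f(avg^k U) dU` for every bounded measurable `f` (§1, (2)/(6) with a test function), hence
**`∫ f d(unitLaw K) = (∫ ρ_K(V)·f(unitShift V) dV_K) / Z`** (§2, `integral_unitLaw_eq_rgTower`): the unit law is `ρ_K dV`
normalised and read on the unit labels.  So the hypotheses `ρ_K` of `continuumYM3Torus_of_densitySandwich[ModConst]` are (a
positive measurable version of) Bałaban's `ρ_K/Z^ε`, and the E3 estimates are literally two-sided bounds on (2)'s densities of two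
consecutive approximations on good sets — the (41)/(47)-type statements the d = 3 papers are about, compared ACROSS runs.

## Contents

§1 `integral_free_mul`: the push-forward identity along a free `DensityRGI` tower with a bounded measurable test function
   (induction on (2) via `RTOpI.isRT`; integrability carried by `DensityRGI.integrable_all`).
§2 d = 3: `rgTower F ℰ γ K T` (the free tower of the `K`-th approximation started at its Boltzmann weight), `rgTower_partitionFn`
   (`Z^ε = Z_{P,β}`), `integrable_rgTower`, `integral_rgTower_mul`, **`integral_unitLaw_eq_rgTower`**, and the expectation form
   `expectAt_eq_integral_rgTower` (`⟨∏W̄⟩_K = Z⁻¹ ∫ ρ_K(V) ∏_C W_C(unitShift V) dV_K`).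
§3 (v2) `integral_descLaw_eq_rgTower_one`: the descended law of `T3NestedUnitLaws` is `T'_0 ρ'_0 dV / Z'` — one renormalization step
   of the finer run's Boltzmann weight, read on `T_{ε_K}`.
§4 (v2) `unitLaw_eq_withDensity_of_rgTower`: a measurable non-negative integrable version `d` of `Z⁻¹ρ_K ∘ unitShift⁻¹` IS the
   density of `unitLaw K` w.r.t. product Haar on `T₁` (the `hlaw` hypothesis of `continuumYM3Torus_of_densitySandwich[ModConst]`).
-/

noncomputable section

open MeasureTheory Filter Topology
open Literature.MathematicalPhysics.QuantumFieldTheory.Balaban1983to89.T3ContinuumYM3Torus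
open Literature.MathematicalPhysics.QuantumFieldTheory.Balaban1983to89.T3LevelShift
open Literature.MathematicalPhysics.QuantumFieldTheory.Balaban1983to89.T3ThresholdRemoval
open Literature.MathematicalPhysics.QuantumFieldTheory.Balaban1983to89.T3NestedUnitLaws
open Literature.MathematicalPhysics.QuantumFieldTheory.Balaban1983to89.Missing
open Literature.MathematicalPhysics.QuantumFieldTheory.Balaban1983to89.T4Continuum
open Literature.MathematicalPhysics.QuantumFieldTheory.Balaban1983to89.Step

namespace Literature.MathematicalPhysics.QuantumFieldTheory.Balaban1983to89.T3UnitLawDensity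

/-- Products of a list of measurable real functions are measurable (local helper). [folklore] -/
private theorem measurable_list_prod {X : Type*} [MeasurableSpace X] {ι : Type*} (f : ι → X → ℝ)
    (hf : ∀ i, Measurable (f i)) : ∀ l : List ι, Measurable fun x => (l.map fun i => f i x).prod
  | [] => by simp
  | i :: l => by
    show Measurable fun x => f i x * (l.map fun i => f i x).prod
    exact (hf i).mul (measurable_list_prod f hf l)

/-- Products of a list of functions bounded by `1` are bounded by `1` (local helper). [folklore] -/
private theorem abs_list_prod_le_one {X : Type*} {ι : Type*} (f : ι → X → ℝ) (hf : ∀ i x, |f i x| ≤ 1) (x : X) :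
    ∀ l : List ι, |(l.map fun i => f i x).prod| ≤ 1
  | [] => by simp
  | i :: l => by
    rw [List.map_cons, List.prod_cons, abs_mul]
    exact mul_le_one₀ (hf i x) (abs_nonneg _) (abs_list_prod_le_one f hf x l)

/-! ## §1 The push-forward identity along a free tower, with a test function -/

section Free

variable {P : Params} {G : Type*} [GaugeGroup G] [MeasurableSpace G] [HaarData G] {av : ∀ j, Averaging P j G}

/-- Every density of a free tower started at an integrable density with non-zero total mass is integrable
(`DensityRGI.integrable_all`, the large-field operations being identities). [cite: Balaban1985UV3, (6) p.257] -/
theorem integrable_free (T : ∀ j, RTOpI P j G (av j)) {ρ₀ : Density P 0 G} (h0 : Integrable ρ₀ (fieldMeasure P 0 G))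
    (hZ : (DensityRGI.free T ρ₀).partitionFn ≠ 0) (k : ℕ) :
    Integrable ((DensityRGI.free T ρ₀).ρ k) (fieldMeasure P k G) :=
  DensityRGI.integrable_all _ k (fun _ _ _ => rfl) h0 hZ k le_rfl

/-- **(2)/(6) WITH A TEST FUNCTION**: along the free tower `ρ_{k+1} = T_kρ_k`, for every bounded measurable `f` on `T^{(k)}`,
`∫ ρ_k(V)·f(V) dV_k = ∫ ρ₀(U)·f(Ū^k) dU` — the push-forward identity of [Balaban1985Averaging] (10)
«ρ′(V) = ∫dU δ(VŪ^{−1})ρ(U)» iterated (remark (6) of [Balaban1985UV3] is the case `f ≡ 1`). [cite: Balaban1985UV3, (2) p.256 + (6) p.257] -/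
theorem integral_free_mul (T : ∀ j, RTOpI P j G (av j)) {ρ₀ : Density P 0 G} (hav : ∀ j, Measurable (av j).avg)
    (hint : ∀ k, Integrable ((DensityRGI.free T ρ₀).ρ k) (fieldMeasure P k G)) :
    ∀ (k : ℕ) (f : GaugeField P k G → ℝ), Measurable f → (∃ C : ℝ, ∀ V, |f V| ≤ C) →
      ∫ V, (DensityRGI.free T ρ₀).ρ k V * f V ∂fieldMeasure P k G =
        ∫ U, ρ₀ U * f (Averaging.iter av k U) ∂fieldMeasure P 0 G
  | 0, _, _, _ => rfl
  | k + 1, f, hf, hC => by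
    obtain ⟨C, hC⟩ := hC
    have step : ∫ V, (DensityRGI.free T ρ₀).ρ (k + 1) V * f V ∂fieldMeasure P (k + 1) G =
        ∫ U, (DensityRGI.free T ρ₀).ρ k U * f ((av k).avg U) ∂fieldMeasure P k G :=
      (T k).isRT _ (hint k) f hf ⟨C, hC⟩
    rw [step]
    exact integral_free_mul T hav hint k (fun U => f ((av k).avg U)) (hf.comp (hav k)) ⟨C, fun U => hC _⟩

end Free

/-! ## §2 The d = 3 scheme: the unit law is the renormalised density, normalised, read on the unit labels -/

section T3

variable (F : T3Family) {G : Type*} [GaugeGroup G] [MeasurableSpace G] [HaarData G]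
  (ℰ : LoopAverage G) (γ : ℝ) (K : ℕ)
  (T : ∀ j, RTOpI (F.P K) j G (BlockAveraging.blockAvg (P := F.P K) (j := j) ℰ))

/-- **BAŁABAN'S DENSITY TOWER OF THE `K`-TH APPROXIMATION**: the free tower `ρ_{k+1} = T_kρ_k` ([Balaban1985UV3] (2)) over the
scheme's (0.4) block averagings, started at the scheme's Boltzmann weight `ρ₀ = e^{−β_K A}` ((1) with `g₀² = 1/β_K = γε_K`,
`E = 0`), for a given family `T` of renormalization transformations in the inhabited carrier `RTOpI`.
[cite: Balaban1985UV3, (1)–(2) p.256] -/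
def rgTower : DensityRGI (F.P K) G (fun j => BlockAveraging.blockAvg (P := F.P K) (j := j) ℰ) :=
  DensityRGI.free T (boltzmann (F.P K) ((F.scheme ℰ γ).β K))

variable {F ℰ γ K}

/-- `ρ₀` of the tower is the scheme's Boltzmann weight. [cite: Balaban1985UV3, (1) p.256] -/
theorem rgTower_ρ_zero : (rgTower F ℰ γ K T).ρ 0 = boltzmann (F.P K) ((F.scheme ℰ γ).β K) := rfl

/-- `ρ_{k+1} = T_kρ_k`. [cite: Balaban1985UV3, (2) p.256] -/
theorem rgTower_ρ_succ (k : ℕ) : (rgTower F ℰ γ K T).ρ (k + 1) = (T k).T ((rgTower F ℰ γ K T).ρ k) := rfl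

/-- `Z^ε` of the tower is the scheme's partition function `Z_{P,β}`. [cite: Balaban1985UV3, (6) p.257] -/
theorem rgTower_partitionFn : (rgTower F ℰ γ K T).partitionFn = partitionFn (G := G) (F.P K) ((F.scheme ℰ γ).β K) := rfl

/-- Every `ρ_k` of the tower is non-negative (`boltzmann > 0`, `RTOpI.pos`). [cite: Balaban1985UV3, (2) p.256] -/
theorem rgTower_ρ_nonneg : ∀ (k : ℕ) (V : GaugeField (F.P K) k G), 0 ≤ (rgTower F ℰ γ K T).ρ k V
  | 0, V => (boltzmann_pos _ _ V).le
  | k + 1, V => (T k).pos _ (rgTower_ρ_nonneg k) V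

variable [RegularGaugeGroup G]

/-- Every `ρ_k` of the tower is integrable (`γ ≥ 0`). [cite: Balaban1985UV3, (6) p.257] -/
theorem integrable_rgTower (hγ : 0 ≤ γ) (k : ℕ) : Integrable ((rgTower F ℰ γ K T).ρ k) (fieldMeasure (F.P K) k G) :=
  integrable_free T (integrable_boltzmann RegularGaugeGroup.measurable_reTr _ (F.scheme_β_nonneg ℰ hγ K))
    (by exact (partitionFn_pos' (G := G) _ (F.scheme_β_nonneg ℰ hγ K)).ne') k

/-- **(2)/(6) with a test function for the `K`-th approximation**: `∫ ρ_k(V)·f(V) dV_k = ∫ e^{−β_K A(U)}·f(Ū^k) dU`.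
[cite: Balaban1985UV3, (2) p.256 + (6) p.257] -/
theorem integral_rgTower_mul (hE : ℰ.MeasurableE) (hγ : 0 ≤ γ) (k : ℕ) (f : GaugeField (F.P K) k G → ℝ) (hf : Measurable f)
    (hC : ∃ C : ℝ, ∀ V, |f V| ≤ C) :
    ∫ V, (rgTower F ℰ γ K T).ρ k V * f V ∂fieldMeasure (F.P K) k G =
      ∫ U, boltzmann (F.P K) ((F.scheme ℰ γ).β K) U *
        f (Averaging.iter (fun j => BlockAveraging.blockAvg (P := F.P K) (j := j) ℰ) k U) ∂fieldMeasure (F.P K) 0 G :=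
  integral_free_mul T (fun j => F.avgMeasurable_of_measurableE ℰ hE K j) (integrable_rgTower T hγ) k f hf hC

/-- **THE UNIT LAW IS THE RENORMALISED DENSITY, NORMALISED**: for every bounded measurable `f` on the unit-field space,
`∫ f d(unitLaw K) = (∫ ρ_K(V)·f(unitShift V) dV_K) / Z` — the law currency of the E3 node (`T3ThresholdRemoval.unitLaw`,
`T3NestedUnitLaws.continuumYM3Torus_of_densitySandwich`) and the density currency of [Balaban1985UV3] (1)–(2), (6) name the
same object. [cite: Balaban1985UV3, (2) p.256 + (6) p.257] -/
theorem integral_unitLaw_eq_rgTower (hE : ℰ.MeasurableE) (hγ : 0 ≤ γ) (f : GaugeField (F.P 0) 0 G → ℝ) (hf : Measurable f)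
    (hC : ∃ C : ℝ, ∀ u, |f u| ≤ C) :
    ∫ u, f u ∂F.unitLaw ℰ hE γ K =
      (∫ V, (rgTower F ℰ γ K T).ρ K V * f (unitShift F K V) ∂fieldMeasure (F.P K) K G) /
        partitionFn (G := G) (F.P K) ((F.scheme ℰ γ).β K) := by
  obtain ⟨C, hC⟩ := hC
  rw [integral_unitLaw hE K hf, T4GenFunBounds.integral_gibbsMeasure _ (F.scheme_β_nonneg ℰ hγ K),
    integral_rgTower_mul T hE hγ K (fun V => f (unitShift F K V)) (hf.comp (measurable_unitShift F K)) ⟨C, fun V => hC _⟩]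
  congr 1
  refine integral_congr_ae (Eventually.of_forall fun U => ?_)
  exact mul_comm _ _

/-- **JOINT EXPECTATIONS AS INTEGRALS AGAINST THE RENORMALISED DENSITY**:
`⟨∏_{C∈Cs} W̄_C⟩_K = Z⁻¹ ∫ ρ_K(V)·∏_C W_C(unitShift V) dV_K` — the form in which two-sided bounds on `ρ_K`
([Balaban1985UV3] (41)/(47)-type statements, compared across two consecutive approximations) control the expectations.
[cite: Balaban1985UV3, (2) p.256 + (6) p.257] -/
theorem expectAt_eq_integral_rgTower (hE : ℰ.MeasurableE) (hγ : 0 ≤ γ) (Cs : List (ULoop3 F)) :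
    (F.scheme ℰ γ).expectAt K Cs =
      (∫ V, (rgTower F ℰ γ K T).ρ K V * (Cs.map fun C : ULoop3 F => loopAt (unitShift F K V) (C.1.atLevel 0)).prod
          ∂fieldMeasure (F.P K) K G) / partitionFn (G := G) (F.P K) ((F.scheme ℰ γ).β K) := by
  rw [expectAt_eq_integral_unitLaw hE hγ K Cs]
  exact integral_unitLaw_eq_rgTower T hE hγ _
    (measurable_list_prod (fun (C : ULoop3 F) (u : GaugeField (F.P 0) 0 G) => loopAt u (C.1.atLevel 0))
      (fun C => measurable_loopAt _) Cs)
    ⟨1, fun u => abs_list_prod_le_one (fun (C : ULoop3 F) (u : GaugeField (F.P 0) 0 G) => loopAt u (C.1.atLevel 0))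
      (fun _ _ => abs_loopAt_le_one _ _) u Cs⟩

end T3

/-! ## §3 (v2) The descended law is ONE renormalization step of the finer run's Boltzmann weight, as a density on `T_{ε_K}` -/

section Desc

variable (F : T3Family) {G : Type*} [GaugeGroup G] [MeasurableSpace G] [HaarData G] [RegularGaugeGroup G]
  (ℰ : LoopAverage G) (γ : ℝ) (K : ℕ)
  (T' : ∀ j, RTOpI (F.P (K + 1)) j G (BlockAveraging.blockAvg (P := F.P (K + 1)) (j := j) ℰ))

variable {F ℰ γ K}

/-- **THE DESCENDED LAW IS `T ρ'₀ dV / Z'`**: for every bounded measurable `f` on the finest lattice of the `K`-th approximation,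
`∫ f d(descLaw K) = (∫ (T'_0 ρ'_0)(W)·f(fieldShift W) dW) / Z_{K+1}`, where `ρ'_0 = e^{−β_{K+1}A}` is the finer run's Boltzmann weight
([Balaban1985UV3] (1) at `ε_{K+1} = ε_K/L`) and `T'_0` its FIRST renormalization transformation ((2); the first small-field step of
Sect. A) — so the fine venue of the E3 node (`T3NestedUnitLaws`: `Gibbs_K` versus `descLaw K` on `T_{ε_K}`) compares the Wilson
density `e^{−β_K A}` at spacing `ε_K` with the once-renormalised density `T'_0 e^{−β_{K+1}A}` of the finer lattice, read on the same
lattice through the level identification. [cite: Balaban1985UV3, (2) p.256 + (6) p.257] -/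
theorem integral_descLaw_eq_rgTower_one (hE : ℰ.MeasurableE) (hγ : 0 ≤ γ) (f : GaugeField (F.P K) 0 G → ℝ) (hf : Measurable f)
    (hC : ∃ C : ℝ, ∀ V, |f V| ≤ C) :
    ∫ V, f V ∂F.descLaw ℰ hE γ K =
      (∫ W, (rgTower F ℰ γ (K + 1) T').ρ 1 W * f (fieldShift (sitesPerDir_descend F K 0) W)
          ∂fieldMeasure (F.P (K + 1)) 1 G) / partitionFn (G := G) (F.P (K + 1)) ((F.scheme ℰ γ).β (K + 1)) := by
  obtain ⟨C, hC⟩ := hC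
  rw [integral_descLaw hE K hf, T4GenFunBounds.integral_gibbsMeasure _ (F.scheme_β_nonneg ℰ hγ (K + 1)),
    integral_rgTower_mul T' hE hγ 1 (fun W => f (fieldShift (sitesPerDir_descend F K 0) W))
      (hf.comp (measurable_fieldShift _)) ⟨C, fun W => hC _⟩]
  congr 1
  refine integral_congr_ae (Eventually.of_forall fun U => ?_)
  exact mul_comm _ _

end Desc

/-! ## §4 (v2) The density form: a measurable version of `Z⁻¹ρ_K` read on the unit labels IS the density of the unit law -/

section DensityForm

variable {F : T3Family} {G : Type*} [GaugeGroup G] [MeasurableSpace G] [HaarData G] [RegularGaugeGroup G]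
  {ℰ : LoopAverage G} {γ : ℝ} {K : ℕ}
  (T : ∀ j, RTOpI (F.P K) j G (BlockAveraging.blockAvg (P := F.P K) (j := j) ℰ))

/-- Two finite measures with equal integrals of all measurable `f`, `|f| ≤ 1`, are equal (local helper). [folklore] -/
private theorem ext_of_forall_integral_eq {X : Type*} [MeasurableSpace X] {μ ν : Measure X} [IsFiniteMeasure μ]
    [IsFiniteMeasure ν] (h : ∀ f : X → ℝ, Measurable f → (∀ x, |f x| ≤ 1) → ∫ x, f x ∂μ = ∫ x, f x ∂ν) : μ = ν := by
  refine Measure.ext fun s hs => ?_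
  have hb : ∀ y, |s.indicator (1 : X → ℝ) y| ≤ 1 := fun y => by
    by_cases hy : y ∈ s
    · simp [hy]
    · simp [hy]
  have h1 := h _ (measurable_one.indicator hs) hb
  rw [integral_indicator_one hs, integral_indicator_one hs] at h1
  exact (ENNReal.toReal_eq_toReal_iff' (measure_ne_top _ _) (measure_ne_top _ _)).mp h1

/-- **THE UNIT LAW HAS DENSITY `Z⁻¹ρ_K` (read on the unit labels) WITH RESPECT TO PRODUCT HAAR ON `T₁`**: if `d` is a measurable,
non-negative, integrable function on the unit-field space with `d(unitShift V) = ρ_K(V)/Z` for every `V` (a measurable version of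
Bałaban's normalised renormalised density of [Balaban1985UV3] (2)/(6), transported along the unit map), then
`unitLaw K = dV_{T₁}.withDensity d` — the hypothesis `hlaw` of `T3NestedUnitLaws.continuumYM3Torus_of_densitySandwich[ModConst]`
discharged from a renormalization-transformation tower. [cite: Balaban1985UV3, (2) p.256 + (6) p.257] -/
theorem unitLaw_eq_withDensity_of_rgTower (hE : ℰ.MeasurableE) (hγ : 0 ≤ γ) {d : GaugeField (F.P 0) 0 G → ℝ}
    (hd : Measurable d) (hd0 : ∀ u, 0 ≤ d u) (hdi : Integrable d (fieldMeasure (F.P 0) 0 G))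
    (hdρ : ∀ V : GaugeField (F.P K) K G,
      d (unitShift F K V) = (rgTower F ℰ γ K T).ρ K V / partitionFn (G := G) (F.P K) ((F.scheme ℰ γ).β K)) :
    F.unitLaw ℰ hE γ K = (fieldMeasure (F.P 0) 0 G).withDensity (fun u => ENNReal.ofReal (d u)) := by
  haveI := isProbabilityMeasure_unitLaw (F := F) (ℰ := ℰ) hE hγ K
  haveI : IsFiniteMeasure ((fieldMeasure (F.P 0) 0 G).withDensity fun u => ENNReal.ofReal (d u)) :=
    isFiniteMeasure_withDensity_ofReal hdi.2
  refine ext_of_forall_integral_eq fun f hf hb => ?_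
  rw [integral_unitLaw_eq_rgTower T hE hγ f hf ⟨1, hb⟩, T4VarianceMatching.integral_withDensity_ofReal_mul hd hd0 f]
  -- change variables `u = unitShift V` on the right (`unitShift` = `fieldShift` preserves product Haar)
  have hcv : ∫ u, d u * f u ∂fieldMeasure (F.P 0) 0 G =
      ∫ V, d (unitShift F K V) * f (unitShift F K V) ∂fieldMeasure (F.P K) K G :=
    (integral_comp_fieldShift (F.sitesPerDir_unit K) (fun u => d u * f u)).symm
  rw [hcv]
  simp_rw [hdρ]
  rw [← integral_div]
  refine integral_congr_ae (Eventually.of_forall fun V => ?_)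
  ring

end DensityForm

end Literature.MathematicalPhysics.QuantumFieldTheory.Balaban1983to89.T3UnitLawDensity

end
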